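import Literature.NumberTheory.EllipticCurves.IwasawaAlgebraDivisibilityProofs
import HarnessLib

/-!
# Characteristic ideals: length comparison AWAY FROM ONE PRIME ELEMENT `ϖ` ⟹ comparison of `char`
# up to powers of `(ϖ)`

Generic commutative algebra (everything PROVED, nothing assumed), the "away from `p`" companion of the
tree's `Module.exists_pow_mul_mem_charIdeal_of_lengthAt_le` (`IwasawaAlgebraDivisibilityProofs`) and
`Module.le_charIdeal_of_span_pow_mul_le` (`IwasawaAlgebraPromotionProofs`). Over a Noetherian domain `R`
with a prime element `ϖ` (so `(ϖ)` is THE height-one prime containing `ϖ`, Mathlib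
`Ideal.eq_span_singleton_of_height_eq_one`), for finitely generated torsion modules `M`, `N`
(`char M = ∏_{ht 𝔮 = 1} 𝔮^{length M_𝔮}`, Bourbaki AC VII §4.5; NSW (5.3.9)–(5.3.10)):

* `Module.charIdeal_eq_span_pow_mul_finprod_away` — the factor at `(ϖ)` splits off:
  `char M = (ϖ)^{length M_(ϖ)} · ∏_{ht 𝔮 = 1, ϖ ∉ 𝔮} 𝔮^{length M_𝔮}`;
* **`Module.charIdeal_mul_span_pow_eq_of_lengthAt_eq`** — if `length M_𝔮 = length N_𝔮` at every height-one
  `𝔮 ∌ ϖ` then `char M · (ϖ)^{length N_(ϖ)} = char N · (ϖ)^{length M_(ϖ)}`, whence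
  `Module.exists_charIdeal_mul_span_pow_eq_of_lengthAt_eq : ∃ i i', char M · (ϖ)^i = char N · (ϖ)^{i'}`;
* **`Module.charIdeal_dvd_mul_span_pow_of_lengthAt_le`** — if `length M_𝔮 ≤ length N_𝔮` at every height-one
  `𝔮 ∌ ϖ` then `char M ∣ char N · (ϖ)^{length M_(ϖ)}`, whence
  `Module.exists_charIdeal_dvd_mul_span_pow_of_lengthAt_le : ∃ k, char M ∣ char N · (ϖ)^k` and the `≤` form
  `Module.exists_mul_span_pow_le_charIdeal_of_lengthAt_le : ∃ k, char N · (ϖ)^k ≤ char M`;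
* THE CONVERSES over a Noetherian UFD (e.g. `Λ₂ = ℤ₂⟦T₁,T₂⟧`), where every height-one prime is principal and
  `char M = (ϖ^{length M_(ϖ)} · g)` with `ϖ ∤ g` (`Module.exists_charIdeal_eq_span_pow_mul`): the `π`-adic
  multiplicity of a generator of `char M` is `length M_(π)` (`Module.lengthAt_eq_emultiplicity_of_charIdeal_eq_span`),
  hence **`Module.lengthAt_eq_of_charIdeal_mul_span_pow_eq`**, **`Module.lengthAt_le_of_charIdeal_dvd_mul_span_pow`**
  and the two `iff`s `Module.exists_charIdeal_mul_span_pow_eq_iff_lengthAt_eq`,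
  `Module.exists_charIdeal_dvd_mul_span_pow_iff_lengthAt_le`.

WHY (cell `run/shared/lean/pub/bsd-print-cf2/`, planner g20 RULING R-ABRICK (γ3), 2026-08-29): the class-group half
of the two-variable main conjecture at the split prime `2` enters the M-LINE-PIN socket
(`…Theorems.PrintCf2RubinValueTwoLinePinPowFormOfDualInvariantsRat`, hypothesis `ha`) in the shape
`∃ i i', char C.X · (2)^i = char Q · (2)^{i'}` over `Λ₂ = ℤ₂⟦T₁,T₂⟧`, while its printed sources (Kato 2004
Thm. 15.2 (1)(a); Johnson-Leung–Kings 2011 Thm. 5.2 ⊗ ℚ) are families of LENGTH (in)equalities at the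
height-one primes not containing `2`. In `Λ₂` the only height-one prime containing `2` is `(2)`, so the two
currencies agree up to powers of `(2)`; this file is that dictionary, for any Noetherian domain and prime
element. No unique factorisation is needed in this direction (ideal-level statements); the converse
(reading lengths off `char`) is proved over a UFD through Mathlib's `emultiplicity`. BSD is not advanced by this file.

References: N. Bourbaki, *Algèbre commutative* VII §4.4–4.5 (Prop. 10: `char` as a product of height-one
prime powers; the divisor calculus); J. Neukirch, A. Schmidt, K. Wingberg, *Cohomology of Number Fields*
(2nd ed.) Ch. V §3 (5.3.9)–(5.3.10); L. Washington, *Introduction to Cyclotomic Fields* §13.2; K. Kato,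
Astérisque 295 (2004) Thm. 15.2 / 17.4 (statements as length inequalities away from `p`). Mathlib supplies
`finprod_mem_mul_sdiff'`, `finprod_mem_eq_prod_of_inter_mulSupport_eq`, `Finset.prod_dvd_prod_of_dvd`,
`Ideal.eq_span_singleton_of_height_eq_one`, `ENat.toNat_le_toNat`, `emultiplicity_mul`, `emultiplicity_pow_self_of_prime`,
`Prime.exists_mem_finset_dvd`, `Prime.associated_of_dvd`.
-/

noncomputable section

namespace Literature.NumberTheory.EllipticCurves

namespace Module

/-! ### A divisibility lemma for `finprod` over a set -/

section Finprod

variable {α β : Type*} [CommMonoid β]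

/-- Termwise divisibility on `s` gives divisibility of the `finprod`s over `s` (both with finite support on `s`).
Plumbing for the products defining characteristic ideals. [folklore] -/
private theorem finprod_mem_dvd_finprod_mem {s : Set α} {f g : α → β}
    (hf : (s ∩ Function.mulSupport f).Finite) (hg : (s ∩ Function.mulSupport g).Finite)
    (h : ∀ i ∈ s, f i ∣ g i) : ∏ᶠ i ∈ s, f i ∣ ∏ᶠ i ∈ s, g i := by
  classical
  set t : Finset α := (hf.union hg).toFinset with ht
  have hts : ∀ i ∈ t, i ∈ s := by
    intro i hi
    rw [ht, Set.Finite.mem_toFinset] at hi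
    rcases hi with hi | hi <;> exact hi.1
  have hft : s ∩ Function.mulSupport f = ↑t ∩ Function.mulSupport f := by
    ext i
    simp only [ht, Set.Finite.coe_toFinset, Set.mem_inter_iff, Set.mem_union, Function.mem_mulSupport]
    tauto
  have hgt : s ∩ Function.mulSupport g = ↑t ∩ Function.mulSupport g := by
    ext i
    simp only [ht, Set.Finite.coe_toFinset, Set.mem_inter_iff, Set.mem_union, Function.mem_mulSupport]
    tauto
  rw [finprod_mem_eq_prod_of_inter_mulSupport_eq f hft, finprod_mem_eq_prod_of_inter_mulSupport_eq g hgt]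
  exact Finset.prod_dvd_prod_of_dvd f g fun i hi ↦ h i (hts i hi)

end Finprod

/-! ### Splitting off the factor of `char` at the prime `(ϖ)` -/

section Away

variable {R : Type*} [CommRing R] [IsNoetherianRing R] [IsDomain R]
  {M : Type*} [AddCommGroup M] [_root_.Module R M]
  {N : Type*} [AddCommGroup N] [_root_.Module R N]

omit [IsNoetherianRing R] in
/-- For a prime element `ϖ` of a Noetherian domain, the height-one primes OTHER than `(ϖ)` are exactly the
height-one primes NOT CONTAINING `ϖ` (`(ϖ)` is the only height-one prime containing `ϖ`).
[cite: NeukirchSchmidtWingberg2008, Ch. V §3, (5.3.9)–(5.3.10)] -/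
theorem setOf_height_eq_one_diff_span_singleton {ϖ : R} (hϖ : Prime ϖ) :
    {𝔮 : PrimeSpectrum R | 𝔮.asIdeal.height = 1} \
        {⟨Ideal.span {ϖ}, (Ideal.span_singleton_prime hϖ.ne_zero).mpr hϖ⟩} =
      {𝔮 : PrimeSpectrum R | 𝔮.asIdeal.height = 1 ∧ ϖ ∉ 𝔮.asIdeal} := by
  ext 𝔮
  simp only [Set.mem_sdiff, Set.mem_setOf_eq, Set.mem_singleton_iff]
  constructor
  · rintro ⟨h1, hne⟩
    refine ⟨h1, fun hmem ↦ hne (PrimeSpectrum.ext ?_)⟩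
    exact Ideal.eq_span_singleton_of_height_eq_one h1 hmem hϖ
  · rintro ⟨h1, hnot⟩
    refine ⟨h1, fun heq ↦ hnot ?_⟩
    rw [heq]
    exact Ideal.mem_span_singleton_self ϖ

/-- **The factor of `char M` at `(ϖ)` splits off**: for `M` finitely generated torsion over a Noetherian domain and
`ϖ` a prime element, `char M = (ϖ)^{length M_(ϖ)} · ∏_{ht 𝔮 = 1, ϖ ∉ 𝔮} 𝔮^{length M_𝔮}` (the product defining
`char M` is finite; `(ϖ)` has height one). [cite: NeukirchSchmidtWingberg2008, Ch. V §3, (5.3.9)–(5.3.10)]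
[cite: Washington1997, §13.2] -/
theorem charIdeal_eq_span_pow_mul_finprod_away [Module.Finite R M] (hM : Module.IsTorsion R M)
    {ϖ : R} (hϖ : Prime ϖ) :
    charIdeal R M =
      Ideal.span {ϖ} ^ (lengthAt R M ⟨Ideal.span {ϖ}, (Ideal.span_singleton_prime hϖ.ne_zero).mpr hϖ⟩).toNat *
        ∏ᶠ 𝔮 ∈ {𝔮 : PrimeSpectrum R | 𝔮.asIdeal.height = 1 ∧ ϖ ∉ 𝔮.asIdeal},
          𝔮.asIdeal ^ (lengthAt R M 𝔮).toNat := by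
  -- one `s ≠ 0` kills `M`, so the product defining `char M` has finite support
  obtain ⟨s, hsann, hs0⟩ := Submodule.annihilator_top_inter_nonZeroDivisors hM
  have hs : s ≠ 0 := nonZeroDivisors.ne_zero hs0
  have hsM : Module.IsTorsionBy R M s := fun x ↦ Submodule.mem_annihilator.mp hsann x Submodule.mem_top
  have hfin := finite_heightOne_inter_mulSupport hs hsM
  set 𝔭₀ : PrimeSpectrum R := ⟨Ideal.span {ϖ}, (Ideal.span_singleton_prime hϖ.ne_zero).mpr hϖ⟩ with h𝔭₀
  have hsub : ({𝔭₀} : Set (PrimeSpectrum R)) ⊆ {𝔮 : PrimeSpectrum R | 𝔮.asIdeal.height = 1} := by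
    rw [Set.singleton_subset_iff]
    exact height_span_singleton_eq_one_of_prime hϖ
  unfold charIdeal
  rw [← finprod_mem_mul_sdiff' hsub hfin, finprod_mem_singleton, h𝔭₀,
    setOf_height_eq_one_diff_span_singleton hϖ]

/-! ### Length EQUALITY away from `ϖ` ⟹ `char M · (ϖ)^i = char N · (ϖ)^{i'}` -/

/-- **Equal lengths away from `ϖ` give equal characteristic ideals up to powers of `(ϖ)`**: if
`length M_𝔮 = length N_𝔮` at every height-one prime `𝔮 ∌ ϖ` then
`char M · (ϖ)^{length N_(ϖ)} = char N · (ϖ)^{length M_(ϖ)}` (`M`, `N` finitely generated torsion over a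
Noetherian domain, `ϖ` a prime element). [cite: NeukirchSchmidtWingberg2008, Ch. V §3, (5.3.9)–(5.3.10)]
[cite: Washington1997, §13.2] -/
theorem charIdeal_mul_span_pow_eq_of_lengthAt_eq [Module.Finite R M] [Module.Finite R N]
    (hM : Module.IsTorsion R M) (hN : Module.IsTorsion R N) {ϖ : R} (hϖ : Prime ϖ)
    (h : ∀ 𝔮 : PrimeSpectrum R, 𝔮.asIdeal.height = 1 → ϖ ∉ 𝔮.asIdeal → lengthAt R M 𝔮 = lengthAt R N 𝔮) :
    charIdeal R M *
        Ideal.span {ϖ} ^ (lengthAt R N ⟨Ideal.span {ϖ}, (Ideal.span_singleton_prime hϖ.ne_zero).mpr hϖ⟩).toNat =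
      charIdeal R N *
        Ideal.span {ϖ} ^ (lengthAt R M ⟨Ideal.span {ϖ}, (Ideal.span_singleton_prime hϖ.ne_zero).mpr hϖ⟩).toNat := by
  have haway : ∏ᶠ 𝔮 ∈ {𝔮 : PrimeSpectrum R | 𝔮.asIdeal.height = 1 ∧ ϖ ∉ 𝔮.asIdeal},
        𝔮.asIdeal ^ (lengthAt R M 𝔮).toNat =
      ∏ᶠ 𝔮 ∈ {𝔮 : PrimeSpectrum R | 𝔮.asIdeal.height = 1 ∧ ϖ ∉ 𝔮.asIdeal},
        𝔮.asIdeal ^ (lengthAt R N 𝔮).toNat :=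
    finprod_mem_congr rfl fun 𝔮 h𝔮 ↦ by rw [h 𝔮 h𝔮.1 h𝔮.2]
  rw [charIdeal_eq_span_pow_mul_finprod_away hM hϖ, charIdeal_eq_span_pow_mul_finprod_away hN hϖ, haway]
  ring

/-- **`∃ i i', char M · (ϖ)^i = char N · (ϖ)^{i'}`** from equal lengths at every height-one prime not containing
the prime element `ϖ` — the shape in which the two-variable main conjecture "up to powers of `p`" is consumed.
[cite: NeukirchSchmidtWingberg2008, Ch. V §3, (5.3.9)–(5.3.10)] [cite: Washington1997, §13.2] -/
theorem exists_charIdeal_mul_span_pow_eq_of_lengthAt_eq [Module.Finite R M] [Module.Finite R N]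
    (hM : Module.IsTorsion R M) (hN : Module.IsTorsion R N) {ϖ : R} (hϖ : Prime ϖ)
    (h : ∀ 𝔮 : PrimeSpectrum R, 𝔮.asIdeal.height = 1 → ϖ ∉ 𝔮.asIdeal → lengthAt R M 𝔮 = lengthAt R N 𝔮) :
    ∃ i i' : ℕ, charIdeal R M * Ideal.span {ϖ} ^ i = charIdeal R N * Ideal.span {ϖ} ^ i' :=
  ⟨_, _, charIdeal_mul_span_pow_eq_of_lengthAt_eq hM hN hϖ h⟩

/-! ### Length INEQUALITY away from `ϖ` ⟹ `char M ∣ char N · (ϖ)^k` -/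

/-- **Smaller lengths away from `ϖ` give divisibility of characteristic ideals up to a power of `(ϖ)`**: if
`length M_𝔮 ≤ length N_𝔮` at every height-one prime `𝔮 ∌ ϖ` then `char M ∣ char N · (ϖ)^{length M_(ϖ)}`
(`M`, `N` finitely generated torsion over a Noetherian domain, `ϖ` a prime element; the factors `𝔮^{length M_𝔮}`,
`𝔮 ≠ (ϖ)`, divide the corresponding factors of `char N`). [cite: NeukirchSchmidtWingberg2008, Ch. V §3, (5.3.9)–(5.3.10)]
[cite: Washington1997, §13.2] -/
theorem charIdeal_dvd_mul_span_pow_of_lengthAt_le [Module.Finite R M] [Module.Finite R N]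
    (hM : Module.IsTorsion R M) (hN : Module.IsTorsion R N) {ϖ : R} (hϖ : Prime ϖ)
    (h : ∀ 𝔮 : PrimeSpectrum R, 𝔮.asIdeal.height = 1 → ϖ ∉ 𝔮.asIdeal → lengthAt R M 𝔮 ≤ lengthAt R N 𝔮) :
    charIdeal R M ∣
      charIdeal R N *
        Ideal.span {ϖ} ^ (lengthAt R M ⟨Ideal.span {ϖ}, (Ideal.span_singleton_prime hϖ.ne_zero).mpr hϖ⟩).toNat := by
  -- finite supports of the two products (from annihilating non-zero-divisors)
  obtain ⟨s, hsann, hs0⟩ := Submodule.annihilator_top_inter_nonZeroDivisors hM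
  have hs : s ≠ 0 := nonZeroDivisors.ne_zero hs0
  have hsM : Module.IsTorsionBy R M s := fun x ↦ Submodule.mem_annihilator.mp hsann x Submodule.mem_top
  obtain ⟨s', hs'ann, hs'0⟩ := Submodule.annihilator_top_inter_nonZeroDivisors hN
  have hs' : s' ≠ 0 := nonZeroDivisors.ne_zero hs'0
  have hs'N : Module.IsTorsionBy R N s' := fun x ↦ Submodule.mem_annihilator.mp hs'ann x Submodule.mem_top
  have hfinM := finite_heightOne_inter_mulSupport hs hsM
  have hfinN := finite_heightOne_inter_mulSupport hs' hs'N
  have hsubset : {𝔮 : PrimeSpectrum R | 𝔮.asIdeal.height = 1 ∧ ϖ ∉ 𝔮.asIdeal} ⊆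
      {𝔮 : PrimeSpectrum R | 𝔮.asIdeal.height = 1} := fun 𝔮 h𝔮 ↦ h𝔮.1
  -- the away parts divide termwise
  have haway : ∏ᶠ 𝔮 ∈ {𝔮 : PrimeSpectrum R | 𝔮.asIdeal.height = 1 ∧ ϖ ∉ 𝔮.asIdeal},
        𝔮.asIdeal ^ (lengthAt R M 𝔮).toNat ∣
      ∏ᶠ 𝔮 ∈ {𝔮 : PrimeSpectrum R | 𝔮.asIdeal.height = 1 ∧ ϖ ∉ 𝔮.asIdeal},
        𝔮.asIdeal ^ (lengthAt R N 𝔮).toNat := by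
    refine finprod_mem_dvd_finprod_mem ((hfinM.subset (Set.inter_subset_inter_left _ hsubset)))
      ((hfinN.subset (Set.inter_subset_inter_left _ hsubset))) fun 𝔮 h𝔮 ↦ pow_dvd_pow _ ?_
    exact ENat.toNat_le_toNat (h 𝔮 h𝔮.1 h𝔮.2) (lengthAt_ne_top_of_isTorsionBy hs' hs'N 𝔮 h𝔮.1.le)
  rw [charIdeal_eq_span_pow_mul_finprod_away hM hϖ, charIdeal_eq_span_pow_mul_finprod_away hN hϖ]
  obtain ⟨K, hK⟩ := haway
  refine ⟨Ideal.span {ϖ} ^ (lengthAt R N ⟨Ideal.span {ϖ}, (Ideal.span_singleton_prime hϖ.ne_zero).mpr hϖ⟩).toNat * K, ?_⟩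
  rw [hK]
  ring

/-- **`∃ k, char M ∣ char N · (ϖ)^k`** from `length M_𝔮 ≤ length N_𝔮` at every height-one prime not containing the
prime element `ϖ`. [cite: NeukirchSchmidtWingberg2008, Ch. V §3, (5.3.9)–(5.3.10)] [cite: Washington1997, §13.2] -/
theorem exists_charIdeal_dvd_mul_span_pow_of_lengthAt_le [Module.Finite R M] [Module.Finite R N]
    (hM : Module.IsTorsion R M) (hN : Module.IsTorsion R N) {ϖ : R} (hϖ : Prime ϖ)
    (h : ∀ 𝔮 : PrimeSpectrum R, 𝔮.asIdeal.height = 1 → ϖ ∉ 𝔮.asIdeal → lengthAt R M 𝔮 ≤ lengthAt R N 𝔮) :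
    ∃ k : ℕ, charIdeal R M ∣ charIdeal R N * Ideal.span {ϖ} ^ k :=
  ⟨_, charIdeal_dvd_mul_span_pow_of_lengthAt_le hM hN hϖ h⟩

/-- **`∃ k, char N · (ϖ)^k ⊆ char M`** (the containment form of the divisibility) from `length M_𝔮 ≤ length N_𝔮` at
every height-one prime not containing the prime element `ϖ`. [cite: NeukirchSchmidtWingberg2008, Ch. V §3, (5.3.9)–(5.3.10)]
[cite: Washington1997, §13.2] -/
theorem exists_mul_span_pow_le_charIdeal_of_lengthAt_le [Module.Finite R M] [Module.Finite R N]
    (hM : Module.IsTorsion R M) (hN : Module.IsTorsion R N) {ϖ : R} (hϖ : Prime ϖ)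
    (h : ∀ 𝔮 : PrimeSpectrum R, 𝔮.asIdeal.height = 1 → ϖ ∉ 𝔮.asIdeal → lengthAt R M 𝔮 ≤ lengthAt R N 𝔮) :
    ∃ k : ℕ, charIdeal R N * Ideal.span {ϖ} ^ k ≤ charIdeal R M := by
  obtain ⟨k, hk⟩ := exists_charIdeal_dvd_mul_span_pow_of_lengthAt_le hM hN hϖ h
  exact ⟨k, Ideal.le_of_dvd hk⟩

end Away

/-! ### The converses over a Noetherian UFD: reading `length M_(π)` off a generator of `char M` -/

section Converse

variable {R : Type*} [CommRing R] [IsNoetherianRing R] [IsDomain R] [UniqueFactorizationMonoid R]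
  {M : Type*} [AddCommGroup M] [_root_.Module R M]
  {N : Type*} [AddCommGroup N] [_root_.Module R N]

/-- Finite local lengths of a finitely generated torsion module at primes of height `≤ 1` (it is killed by a
non-zero-divisor). Plumbing form of the tree's `lengthAt_ne_top_of_isTorsionBy`. [folklore] -/
private theorem lengthAt_ne_top_of_isTorsion_aux {R : Type*} [CommRing R] [IsNoetherianRing R] [IsDomain R]
    {M : Type*} [AddCommGroup M] [_root_.Module R M] [Module.Finite R M] (hM : Module.IsTorsion R M)
    (𝔭 : PrimeSpectrum R) (h𝔭 : 𝔭.asIdeal.height ≤ 1) : lengthAt R M 𝔭 ≠ ⊤ := by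
  obtain ⟨s, hs, hs0⟩ := Submodule.annihilator_top_inter_nonZeroDivisors hM
  exact lengthAt_ne_top_of_isTorsionBy (nonZeroDivisors.ne_zero hs0)
    (fun m ↦ Submodule.mem_annihilator.mp hs m Submodule.mem_top) 𝔭 h𝔭

/-- **Over a Noetherian UFD the away-from-`π` part of `char M` is principal, with a generator prime to `π`**:
`∏_{ht 𝔮 = 1, π ∉ 𝔮} 𝔮^{length M_𝔮} = (g)`, `π ∤ g` (every height-one prime is `(ρ)` for a prime element `ρ`, and
`π ∣ ρ` would force `(π) = (ρ) ∋ π`). [cite: NeukirchSchmidtWingberg2008, Ch. V §3, (5.3.9)–(5.3.10)] [cite: Washington1997, §13.2] -/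
theorem exists_finprod_away_eq_span [Module.Finite R M] (hM : Module.IsTorsion R M) {π : R} (hπ : Prime π) :
    ∃ g : R, ¬ π ∣ g ∧
      ∏ᶠ 𝔮 ∈ {𝔮 : PrimeSpectrum R | 𝔮.asIdeal.height = 1 ∧ π ∉ 𝔮.asIdeal},
          𝔮.asIdeal ^ (lengthAt R M 𝔮).toNat = Ideal.span {g} := by
  classical
  obtain ⟨s, hsann, hs0⟩ := Submodule.annihilator_top_inter_nonZeroDivisors hM
  have hs : s ≠ 0 := nonZeroDivisors.ne_zero hs0
  have hsM : Module.IsTorsionBy R M s := fun x ↦ Submodule.mem_annihilator.mp hsann x Submodule.mem_top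
  set F : PrimeSpectrum R → Ideal R := fun 𝔮 ↦ 𝔮.asIdeal ^ (lengthAt R M 𝔮).toNat with hF
  have hfin : ({𝔮 : PrimeSpectrum R | 𝔮.asIdeal.height = 1 ∧ π ∉ 𝔮.asIdeal} ∩ Function.mulSupport F).Finite :=
    (finite_heightOne_inter_mulSupport hs hsM).subset
      (Set.inter_subset_inter_left _ fun 𝔮 h𝔮 ↦ h𝔮.1)
  set t : Finset (PrimeSpectrum R) := hfin.toFinset with ht
  have hprod : ∏ᶠ 𝔮 ∈ {𝔮 : PrimeSpectrum R | 𝔮.asIdeal.height = 1 ∧ π ∉ 𝔮.asIdeal}, F 𝔮 = ∏ 𝔮 ∈ t, F 𝔮 := by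
    refine finprod_mem_eq_prod_of_inter_mulSupport_eq F ?_
    rw [ht, Set.Finite.coe_toFinset, Set.inter_assoc, Set.inter_self]
  -- members of `t`: height one, `π ∉ 𝔮`, `s ∈ 𝔮`
  have hmem : ∀ 𝔮 ∈ t, 𝔮.asIdeal.height = 1 ∧ π ∉ 𝔮.asIdeal ∧ s ∈ 𝔮.asIdeal := by
    intro 𝔮 h𝔮
    rw [ht, Set.Finite.mem_toFinset] at h𝔮
    refine ⟨h𝔮.1.1, h𝔮.1.2, ?_⟩
    by_contra hns
    exact h𝔮.2 (by simp [F, lengthAt_eq_zero_of_isTorsionBy hsM 𝔮 hns])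
  -- hence generated by prime elements
  have hgen : ∀ 𝔮 ∈ t, ∃ ρ : R, Prime ρ ∧ 𝔮.asIdeal = Ideal.span {ρ} := by
    intro 𝔮 h𝔮
    obtain ⟨h1, -, hs𝔮⟩ := hmem 𝔮 h𝔮
    have hne : 𝔮.asIdeal ≠ ⊥ := fun hbot ↦ hs (by rwa [hbot, Ideal.mem_bot] at hs𝔮)
    obtain ⟨ρ, hρ𝔮, hρ⟩ := Ideal.IsPrime.exists_mem_prime_of_ne_bot 𝔮.isPrime hne
    exact ⟨ρ, hρ, Ideal.eq_span_singleton_of_height_eq_one h1 hρ𝔮 hρ⟩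
  choose! ρ hρ hρeq using hgen
  refine ⟨∏ 𝔮 ∈ t, ρ 𝔮 ^ (lengthAt R M 𝔮).toNat, fun hdvd ↦ ?_, ?_⟩
  · obtain ⟨𝔮, h𝔮, h𝔮dvd⟩ := hπ.exists_mem_finset_dvd hdvd
    have hass : Associated π (ρ 𝔮) := hπ.associated_of_dvd (hρ 𝔮 h𝔮) (hπ.dvd_of_dvd_pow h𝔮dvd)
    refine (hmem 𝔮 h𝔮).2.1 ?_
    rw [hρeq 𝔮 h𝔮, ← Ideal.span_singleton_eq_span_singleton.mpr hass]
    exact Ideal.mem_span_singleton_self π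
  · rw [hprod, ← Ideal.prod_span_singleton]
    refine Finset.prod_congr rfl fun 𝔮 h𝔮 ↦ ?_
    simp only [F]
    rw [hρeq 𝔮 h𝔮, Ideal.span_singleton_pow]

/-- **`char M = (π^{length M_(π)} · g)` with `π ∤ g`** for `M` finitely generated torsion over a Noetherian UFD and `π` a
prime element (Bourbaki AC VII §4.5; Washington §13.2: `char` is principal, a product of prime powers).
[cite: NeukirchSchmidtWingberg2008, Ch. V §3, (5.3.9)–(5.3.10)] [cite: Washington1997, §13.2] -/
theorem exists_charIdeal_eq_span_pow_mul [Module.Finite R M] (hM : Module.IsTorsion R M) {π : R} (hπ : Prime π) :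
    ∃ g : R, ¬ π ∣ g ∧ charIdeal R M =
      Ideal.span {π ^ (lengthAt R M ⟨Ideal.span {π}, (Ideal.span_singleton_prime hπ.ne_zero).mpr hπ⟩).toNat * g} := by
  obtain ⟨g, hg, hA⟩ := exists_finprod_away_eq_span hM hπ
  refine ⟨g, hg, ?_⟩
  rw [charIdeal_eq_span_pow_mul_finprod_away hM hπ, hA, Ideal.span_singleton_pow,
    Ideal.span_singleton_mul_span_singleton]

/-- **The `π`-adic multiplicity of any generator of `char M` is `length M_(π)`** (`M` finitely generated torsion over a
Noetherian UFD, `π` a prime element): if `char M = (f)` then `emultiplicity π f = length M_(π)`.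
[cite: NeukirchSchmidtWingberg2008, Ch. V §3, (5.3.9)–(5.3.10)] [cite: Washington1997, §13.2] -/
theorem lengthAt_eq_emultiplicity_of_charIdeal_eq_span [Module.Finite R M] (hM : Module.IsTorsion R M) {π : R}
    (hπ : Prime π) {f : R} (hf : charIdeal R M = Ideal.span {f}) :
    lengthAt R M ⟨Ideal.span {π}, (Ideal.span_singleton_prime hπ.ne_zero).mpr hπ⟩ = emultiplicity π f := by
  have hfin : lengthAt R M ⟨Ideal.span {π}, (Ideal.span_singleton_prime hπ.ne_zero).mpr hπ⟩ ≠ ⊤ :=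
    lengthAt_ne_top_of_isTorsion_aux hM _ (height_span_singleton_eq_one_of_prime hπ).le
  obtain ⟨g, hg, hchar⟩ := exists_charIdeal_eq_span_pow_mul hM hπ
  set n : ℕ := (lengthAt R M ⟨Ideal.span {π}, (Ideal.span_singleton_prime hπ.ne_zero).mpr hπ⟩).toNat with hn
  have hass : Associated f (π ^ n * g) := by
    rw [← Ideal.span_singleton_eq_span_singleton, ← hf, hchar]
  rw [emultiplicity_eq_of_associated_right hass, emultiplicity_mul hπ, emultiplicity_pow_self_of_prime hπ,
    emultiplicity_eq_zero.mpr hg, add_zero]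
  exact (ENat.coe_toNat hfin).symm

/-- **CONVERSE, equality form**: if `char M · (ϖ)^i = char N · (ϖ)^{i'}` then `length M_𝔮 = length N_𝔮` at every
height-one prime `𝔮 ∌ ϖ` (`M`, `N` finitely generated torsion over a Noetherian UFD, `ϖ` any element): write
`𝔮 = (π)` and compare `π`-adic multiplicities of generators (`π ∤ ϖ`).
[cite: NeukirchSchmidtWingberg2008, Ch. V §3, (5.3.9)–(5.3.10)] [cite: Washington1997, §13.2] -/
theorem lengthAt_eq_of_charIdeal_mul_span_pow_eq [Module.Finite R M] [Module.Finite R N]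
    (hM : Module.IsTorsion R M) (hN : Module.IsTorsion R N) {ϖ : R} {i i' : ℕ}
    (h : charIdeal R M * Ideal.span {ϖ} ^ i = charIdeal R N * Ideal.span {ϖ} ^ i')
    (𝔮 : PrimeSpectrum R) (h1 : 𝔮.asIdeal.height = 1) (hϖ𝔮 : ϖ ∉ 𝔮.asIdeal) :
    lengthAt R M 𝔮 = lengthAt R N 𝔮 := by
  obtain ⟨π, hπ𝔮, hπ⟩ := Ideal.IsPrime.exists_mem_prime_of_ne_bot 𝔮.isPrime (Ideal.ne_bot_of_height_eq_one h1)
  have h𝔮eq : 𝔮.asIdeal = Ideal.span {π} := Ideal.eq_span_singleton_of_height_eq_one h1 hπ𝔮 hπ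
  have h𝔮pt : 𝔮 = ⟨Ideal.span {π}, (Ideal.span_singleton_prime hπ.ne_zero).mpr hπ⟩ := PrimeSpectrum.ext h𝔮eq
  have hπϖ : ¬ π ∣ ϖ := fun hd ↦ hϖ𝔮 (h𝔮eq ▸ Ideal.mem_span_singleton.mpr hd)
  have hϖj : ∀ j : ℕ, emultiplicity π (ϖ ^ j) = 0 := fun j ↦
    emultiplicity_eq_zero.mpr fun hd ↦ hπϖ (hπ.dvd_of_dvd_pow hd)
  obtain ⟨gM, hgM, hcM⟩ := exists_charIdeal_eq_span_pow_mul hM hπ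
  obtain ⟨gN, hgN, hcN⟩ := exists_charIdeal_eq_span_pow_mul hN hπ
  have hmM := lengthAt_eq_emultiplicity_of_charIdeal_eq_span hM hπ hcM
  have hmN := lengthAt_eq_emultiplicity_of_charIdeal_eq_span hN hπ hcN
  rw [hcM, hcN, Ideal.span_singleton_pow, Ideal.span_singleton_pow, Ideal.span_singleton_mul_span_singleton,
    Ideal.span_singleton_mul_span_singleton, Ideal.span_singleton_eq_span_singleton] at h
  have key := emultiplicity_eq_of_associated_right (a := π) h
  rw [emultiplicity_mul hπ (b := ϖ ^ i), emultiplicity_mul hπ (b := ϖ ^ i'), hϖj, hϖj, add_zero, add_zero,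
    ← hmM, ← hmN] at key
  rw [h𝔮pt]
  exact key

/-- **CONVERSE, one-sided form**: if `char M ∣ char N · (ϖ)^k` then `length M_𝔮 ≤ length N_𝔮` at every height-one prime
`𝔮 ∌ ϖ` (`M`, `N` finitely generated torsion over a Noetherian UFD, `ϖ` any element).
[cite: NeukirchSchmidtWingberg2008, Ch. V §3, (5.3.9)–(5.3.10)] [cite: Washington1997, §13.2] -/
theorem lengthAt_le_of_charIdeal_dvd_mul_span_pow [Module.Finite R M] [Module.Finite R N]
    (hM : Module.IsTorsion R M) (hN : Module.IsTorsion R N) {ϖ : R} {k : ℕ}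
    (h : charIdeal R M ∣ charIdeal R N * Ideal.span {ϖ} ^ k)
    (𝔮 : PrimeSpectrum R) (h1 : 𝔮.asIdeal.height = 1) (hϖ𝔮 : ϖ ∉ 𝔮.asIdeal) :
    lengthAt R M 𝔮 ≤ lengthAt R N 𝔮 := by
  obtain ⟨π, hπ𝔮, hπ⟩ := Ideal.IsPrime.exists_mem_prime_of_ne_bot 𝔮.isPrime (Ideal.ne_bot_of_height_eq_one h1)
  have h𝔮eq : 𝔮.asIdeal = Ideal.span {π} := Ideal.eq_span_singleton_of_height_eq_one h1 hπ𝔮 hπ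
  have h𝔮pt : 𝔮 = ⟨Ideal.span {π}, (Ideal.span_singleton_prime hπ.ne_zero).mpr hπ⟩ := PrimeSpectrum.ext h𝔮eq
  have hπϖ : ¬ π ∣ ϖ := fun hd ↦ hϖ𝔮 (h𝔮eq ▸ Ideal.mem_span_singleton.mpr hd)
  have hϖj : ∀ j : ℕ, emultiplicity π (ϖ ^ j) = 0 := fun j ↦
    emultiplicity_eq_zero.mpr fun hd ↦ hπϖ (hπ.dvd_of_dvd_pow hd)
  obtain ⟨gM, hgM, hcM⟩ := exists_charIdeal_eq_span_pow_mul hM hπ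
  obtain ⟨gN, hgN, hcN⟩ := exists_charIdeal_eq_span_pow_mul hN hπ
  have hmM := lengthAt_eq_emultiplicity_of_charIdeal_eq_span hM hπ hcM
  have hmN := lengthAt_eq_emultiplicity_of_charIdeal_eq_span hN hπ hcN
  rw [hcM, hcN, Ideal.span_singleton_pow, Ideal.span_singleton_mul_span_singleton] at h
  have hdvd := Ideal.span_singleton_le_span_singleton.mp (Ideal.le_of_dvd h)
  have key := emultiplicity_le_emultiplicity_of_dvd_right (a := π) hdvd
  rw [emultiplicity_mul hπ (b := ϖ ^ k), hϖj, add_zero, ← hmM, ← hmN] at key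
  rw [h𝔮pt]
  exact key

/-- **`∃ i i', char M · (ϖ)^i = char N · (ϖ)^{i'}` ⟺ `length M_𝔮 = length N_𝔮` at every height-one `𝔮 ∌ ϖ`**
(`M`, `N` finitely generated torsion over a Noetherian UFD, `ϖ` a prime element; over `Λ₂ = ℤ_p⟦T₁,T₂⟧` with `ϖ = p`:
the `⊗ℚ` form of a main-conjecture identity versus its length form).
[cite: NeukirchSchmidtWingberg2008, Ch. V §3, (5.3.9)–(5.3.10)] [cite: Washington1997, §13.2] -/
theorem exists_charIdeal_mul_span_pow_eq_iff_lengthAt_eq [Module.Finite R M] [Module.Finite R N]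
    (hM : Module.IsTorsion R M) (hN : Module.IsTorsion R N) {ϖ : R} (hϖ : Prime ϖ) :
    (∃ i i' : ℕ, charIdeal R M * Ideal.span {ϖ} ^ i = charIdeal R N * Ideal.span {ϖ} ^ i') ↔
      ∀ 𝔮 : PrimeSpectrum R, 𝔮.asIdeal.height = 1 → ϖ ∉ 𝔮.asIdeal → lengthAt R M 𝔮 = lengthAt R N 𝔮 :=
  ⟨fun ⟨_, _, h⟩ 𝔮 h1 hϖ𝔮 ↦ lengthAt_eq_of_charIdeal_mul_span_pow_eq hM hN h 𝔮 h1 hϖ𝔮,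
    fun h ↦ exists_charIdeal_mul_span_pow_eq_of_lengthAt_eq hM hN hϖ h⟩

/-- **`∃ k, char M ∣ char N · (ϖ)^k` ⟺ `length M_𝔮 ≤ length N_𝔮` at every height-one `𝔮 ∌ ϖ`** (`M`, `N` finitely
generated torsion over a Noetherian UFD, `ϖ` a prime element; over `Λ₂`, `ϖ = p`: the one-sided, Selmer-bounding half in the
currency of Kato's Thm. 15.2 (1)(a)). [cite: NeukirchSchmidtWingberg2008, Ch. V §3, (5.3.9)–(5.3.10)] [cite: Washington1997, §13.2] -/
theorem exists_charIdeal_dvd_mul_span_pow_iff_lengthAt_le [Module.Finite R M] [Module.Finite R N]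
    (hM : Module.IsTorsion R M) (hN : Module.IsTorsion R N) {ϖ : R} (hϖ : Prime ϖ) :
    (∃ k : ℕ, charIdeal R M ∣ charIdeal R N * Ideal.span {ϖ} ^ k) ↔
      ∀ 𝔮 : PrimeSpectrum R, 𝔮.asIdeal.height = 1 → ϖ ∉ 𝔮.asIdeal → lengthAt R M 𝔮 ≤ lengthAt R N 𝔮 :=
  ⟨fun ⟨_, h⟩ 𝔮 h1 hϖ𝔮 ↦ lengthAt_le_of_charIdeal_dvd_mul_span_pow hM hN h 𝔮 h1 hϖ𝔮,
    fun h ↦ exists_charIdeal_dvd_mul_span_pow_of_lengthAt_le hM hN hϖ h⟩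

end Converse

end Module

end Literature.NumberTheory.EllipticCurves

end
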